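import Summits.AtomisticToContinuum.Crystallization.Theorems.HullExactificationCascadeHcpLandscapeGapExactBarlowPricingAllWords
import Summits.AtomisticToContinuum.Crystallization.Theorems.HullExactificationCascadeHcpLandscapeGapStubShellGeometry
import Summits.AtomisticToContinuum.Crystallization.Theorems.HullExactificationCascadeHcpLandscapeGapStubBoxMinimiser

/-!
# Route HullExactificationCascade — crux B `HcpLandscapeGap` (stmt-AtomisticToContinuum-12087), line `birth`:
# **B holds on the exact Barlow class** (lead c5)

The crux B, its conclusion verbatim up to ζ-reduction of its two `let`s (witness `(a,h)` in B's box; `2·e_LJ(hcp a h)·#(S ∩ B̄_L(c)) +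
κ(η)·#{y ∈ S ∩ B̄_L(c) : unscaled 13/10·a-shell not η-congruent to the hcp(a,h) shell} − C(L+1)² ≤ Σ_{y ∈ S ∩ B̄_L(c)}
Σ'_{z ∈ S, z ≠ y} V_LJ(|y − z|)` for all `c`, `L ≥ 0`), for every EXACT rigid image
`S = v + B '' barlowStacking a' h' s` of a uniform Barlow stacking — every Hägg word `s` (every stacking order,
aperiodic included), every scale in the HcpDefectCounting box `47/50 ≤ a' ≤ 1`, `39/50·a' ≤ h' ≤ 17/20·a'`, every
linear isometry `B` and translation `v`.  (B itself asks this for all δ-separated, everywhere 1/20-good,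
Barlow-TEMPLATED `S`; the exact class is its unrelaxed core.)

Proof.  The witness is the landed box minimiser (`stub_boxMinimiser`, enclosed by `stub_boxMinimiserRigid`).  For
`η > 0`, `stub_shellGeometry` (separation `7/10`) gives `θ > 0` such that a site whose radius-4 neighbourhood in
`S` is two-way `θ`-matched to `hcp(a,h)` has an `η`-congruent shell; `exactBarlowPricingAllWords` prices the
other sites of every window at rate `κ₀` with allowance `C₀(L+1)²`; `stub_boundaryLayer` converts
`2·𝓔_LJ(window)` into the sum of the infinite-volume site energies up to `C₁(L+1)²` and bounds the depth-5 boundary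
layer, where window-matching and set-matching may differ (pattern of `masterT_at`).  All `[folklore]`.
-/

namespace Summit.AtomisticToContinuum.Crystallization.Theorems.HcpLandscapeGapBirth

/-- **Crux B on the exact Barlow class** (registered stub `stub_hcpLandscapeGap_exactBarlow` of the skeleton of
stmt-AtomisticToContinuum-12087): B's conclusion (the `let T`/`let P` of the route decl ζ-reduced — the registry cannot hold
`let … :=` in a signature — hence definitionally B's text) for every exact rigid image of a uniform Barlow
stacking at a scale in the HcpDefectCounting box. [folklore] -/
theorem stub_hcpLandscapeGap_exactBarlow : ∃ a h : ℝ, ∃ ha : a ≠ 0, ∃ hh : h ≠ 0, (9 / 10 < a ∧ a < 1 ∧ |h - a * Real.sqrt (2 / 3)| ≤ a / 100) ∧ (∀ η : ℝ, 0 < η → ∃ κ : ℝ, 0 < κ ∧ ∃ C : ℝ, ∀ (a' h' : ℝ), 47 / 50 ≤ a' → a' ≤ 1 → 39 / 50 * a' ≤ h' → h' ≤ 17 / 20 * a' → ∀ s : ℤ → ℤ, Literature.MathematicalPhysics.StatisticalMechanics.IsHaggSeq s → ∀ (B : EuclideanSpace ℝ (Fin 3) →ₗᵢ[ℝ] EuclideanSpace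 ℝ (Fin 3)) (v c : EuclideanSpace ℝ (Fin 3)) (L : ℝ), 0 ≤ L → 2 * ((Literature.MathematicalPhysics.StatisticalMechanics.hcpPeriodicConfiguration ha hh).energyPerParticle Literature.MathematicalPhysics.StatisticalMechanics.lennardJones) * (({y : EuclideanSpace ℝ (Fin 3) | y ∈ ((fun w => v + B w) '' Literature.MathematicalPhysics.StatisticalMechanics.barlowStacking a' h' s) ∧ dist y c ≤ L} : Set (EuclideanSpace ℝ (Fin 3))).ncard : ℝ) + κ * (({y : EuclideanSpace ℝ (Fin 3) | y ∈ ((fun w => v + B w) '' Literature.MathematicalPhysics.StatisticalMechanics.barlowStacking a' h' s) ∧ dist y c ≤ L ∧ ¬ (∃ A : EuclideanSpace ℝ (Fin 3) →ₗᵢ[ℝ] EuclideanSpace ℝ (Fin 3), ∃ e : ↥{z : EuclideanSpace ℝ (Fin 3) | z ∈ ((fun w => v + B w) '' Literature.MathematicalPhysics.StatisticalMechanics.barlowStacking a' h' s) ∧ z ≠ y ∧ dist z y < 13 / 10 * a} ≃ ↥{p : EuclideanSpace ℝ (Fin 3) | p ∈ Literature.MathematicalPhysics.StatisticalMechanics.hcpStacking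 a h ∧ p ≠ 0 ∧ ‖p‖ < 13 / 10 * a}, ∀ t : ↥{z : EuclideanSpace ℝ (Fin 3) | z ∈ ((fun w => v + B w) '' Literature.MathematicalPhysics.StatisticalMechanics.barlowStacking a' h' s) ∧ z ≠ y ∧ dist z y < 13 / 10 * a}, dist ((t : EuclideanSpace ℝ (Fin 3)) - y) (A ((e t : ↥{p : EuclideanSpace ℝ (Fin 3) | p ∈ Literature.MathematicalPhysics.StatisticalMechanics.hcpStacking a h ∧ p ≠ 0 ∧ ‖p‖ < 13 / 10 * a}) : EuclideanSpace ℝ (Fin 3))) ≤ η)} : Set (EuclideanSpace ℝ (Fin 3))).ncard : ℝ) - C * (L + 1) ^ 2 ≤ (∑' y : ↥{y : EuclideanSpace ℝ (Fin 3) | y ∈ ((fun w => v + B w) '' Literature.MathematicalPhysics.StatisticalMechanics.barlowStacking a' h' s) ∧ dist y c ≤ L}, (∑' z : ↥{z : EuclideanSpace ℝ (Fin 3) | z ∈ ((fun w => v + B w) '' Literature.MathematicalPhysics.StatisticalMechanics.barlowStacking a' h' s) ∧ z ≠ (y : EuclideanSpace ℝ (Fin 3))}, Literature.MathematicalPhysics.StatisticalMechanics.lennardJones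 (dist (y : EuclideanSpace ℝ (Fin 3)) (z : EuclideanSpace ℝ (Fin 3)))))) := by
  classical
  obtain ⟨a, h, ha, hh, hbox, hmin⟩ := stub_boxMinimiser
  have henc := (stub_boxMinimiserRigid a h ha hh hbox hmin).1
  refine ⟨a, h, ha, hh, hbox, ?_⟩
  intro η hη
  obtain ⟨θ, hθ, hgeo⟩ := stub_shellGeometry a h ha hh henc.1 henc.2 (7 / 10) (by norm_num) η hη
  obtain ⟨κ₀, hκ₀, C₀, hcoer⟩ := exactBarlowPricingAllWords a h ha hh hbox hmin θ hθ
  obtain ⟨C₁, hC₁⟩ := stub_boundaryLayer (7 / 10) (by norm_num) 5 (by norm_num)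
  refine ⟨2 * κ₀, by positivity, C₁ + 2 * κ₀ * C₁ + 2 * C₀, ?_⟩
  intro a' h' ha'1 ha'2 hh'1 hh'2 s hs B v c L hL0
  have ha'0 : 0 < a' := by linarith only [ha'1]
  have hh'0 : 0 < h' := by linarith only [hh'1, ha'1]
  set S : Set (EuclideanSpace ℝ (Fin 3)) :=
    (fun w => v + B w) '' Literature.MathematicalPhysics.StatisticalMechanics.barlowStacking a' h' s with hSdef
  -- separation of the exact image
  have hsep : ∀ y ∈ S, ∀ z ∈ S, y ≠ z → (7 / 10 : ℝ) ≤ dist y z := by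
    rintro y ⟨w₁, hw₁, rfl⟩ z ⟨w₂, hw₂, rfl⟩ hyz
    have hw : w₁ ≠ w₂ := fun h0 => hyz (by rw [h0])
    have hd : dist (v + B w₁) (v + B w₂) = dist w₁ w₂ := by
      rw [dist_add_left, B.dist_map]
    rw [hd]
    have h1 := Literature.MathematicalPhysics.StatisticalMechanics.le_dist_of_mem_barlowStacking a' h' s
      ha'0.le hh'0.le hw₁ hw₂ hw
    have h2 : (7 / 10 : ℝ) ≤ min a' h' := le_min (by linarith only [ha'1]) (by linarith only [hh'1, ha'1])
    linarith only [h1, h2]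
  obtain ⟨hlayer, hcross⟩ := hC₁ S hsep c L hL0
  set W : Set (EuclideanSpace ℝ (Fin 3)) := {y | y ∈ S ∧ dist y c ≤ L} with hW
  have hWfin : W.Finite :=
    Literature.MathematicalPhysics.StatisticalMechanics.finite_of_forall_le_dist_of_subset_closedBall
      (by norm_num : (0 : ℝ) < 7 / 10)
      (fun p hp q hq hpq => hsep p hp.1 q hq.1 hpq) (c := c) (R := L)
      (fun p hp => Metric.mem_closedBall.2 hp.2)
  obtain ⟨n, f, hf⟩ := hWfin.fin_embedding
  have hxW : ∀ i, f i ∈ W := fun i => hf ▸ Set.mem_range_self i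
  have hncard : (W.ncard : ℝ) = n := by
    rw [← hf, Set.ncard_range_of_injective f.injective, Nat.card_eq_fintype_card, Fintype.card_fin]
  -- the exact pricing on the window
  have hK2 := hcoer a' h' ha'1 ha'2 hh'1 hh'2 s hs B v c L hL0 n f f.injective hf
  set NG : Set (Fin n) := {i | ¬ (∃ A : EuclideanSpace ℝ (Fin 3) →ₗᵢ[ℝ] EuclideanSpace ℝ (Fin 3),
        (∀ p ∈ (Literature.MathematicalPhysics.StatisticalMechanics.hcpPeriodicConfiguration ha hh).points,
          ‖p‖ ≤ 4 → ∃ j : Fin n, dist (f j) (f i + A p) ≤ θ) ∧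
        (∀ j : Fin n, dist (f j) (f i) ≤ 4 →
          ∃ p ∈ (Literature.MathematicalPhysics.StatisticalMechanics.hcpPeriodicConfiguration ha hh).points,
            dist (f j) (f i + A p) ≤ θ))} with hNG
  set Lay : Set (EuclideanSpace ℝ (Fin 3)) := {y | y ∈ S ∧ dist y c ≤ L ∧ L - 5 < dist y c} with hLay
  -- B's η-bad set inside the window
  set Bd : Set (EuclideanSpace ℝ (Fin 3)) := {y : EuclideanSpace ℝ (Fin 3) | y ∈ S ∧ dist y c ≤ L ∧
    ¬ (∃ A : EuclideanSpace ℝ (Fin 3) →ₗᵢ[ℝ] EuclideanSpace ℝ (Fin 3), ∃ e : ↥{z : EuclideanSpace ℝ (Fin 3) | z ∈ S ∧ z ≠ y ∧ dist z y < 13 / 10 * a} ≃ ↥{p : EuclideanSpace ℝ (Fin 3) | p ∈ Literature.MathematicalPhysics.StatisticalMechanics.hcpStacking a h ∧ p ≠ 0 ∧ ‖p‖ < 13 / 10 * a},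
        ∀ t : ↥{z : EuclideanSpace ℝ (Fin 3) | z ∈ S ∧ z ≠ y ∧ dist z y < 13 / 10 * a},
          dist ((t : EuclideanSpace ℝ (Fin 3)) - y) (A ((e t : ↥{p : EuclideanSpace ℝ (Fin 3) | p ∈ Literature.MathematicalPhysics.StatisticalMechanics.hcpStacking a h ∧ p ≠ 0 ∧ ‖p‖ < 13 / 10 * a}) : EuclideanSpace ℝ (Fin 3))) ≤ η)}
    with hBd
  have hcardNG : (Nat.card {i : Fin n // ¬ (∃ A : EuclideanSpace ℝ (Fin 3) →ₗᵢ[ℝ] EuclideanSpace ℝ (Fin 3),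
        (∀ p ∈ (Literature.MathematicalPhysics.StatisticalMechanics.hcpPeriodicConfiguration ha hh).points,
          ‖p‖ ≤ 4 → ∃ j : Fin n, dist (f j) (f i + A p) ≤ θ) ∧
        (∀ j : Fin n, dist (f j) (f i) ≤ 4 →
          ∃ p ∈ (Literature.MathematicalPhysics.StatisticalMechanics.hcpPeriodicConfiguration ha hh).points,
            dist (f j) (f i + A p) ≤ θ))} : ℝ) = (NG.ncard : ℝ) := by
    rw [← Nat.card_coe_set_eq, hNG, Set.coe_setOf]
  -- η-bad window sites are either not window-Good or within depth 5 of the boundary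
  have hsub : Bd ⊆ (fun i => (f i : EuclideanSpace ℝ (Fin 3))) '' NG ∪ Lay := by
    intro y hy
    obtain ⟨hyS, hyL, hyBad⟩ := hy
    by_cases hdepth : L - 5 < dist y c
    · exact Or.inr ⟨hyS, hyL, hdepth⟩
    · push Not at hdepth
      have hyW : y ∈ Set.range f := hf ▸ (⟨hyS, hyL⟩ : y ∈ W)
      obtain ⟨i, rfl⟩ := hyW
      refine Or.inl ⟨i, ?_, rfl⟩
      intro hgoodi
      obtain ⟨A, hA1, hA2⟩ := hgoodi
      refine hyBad ((hgeo S hsep (f i) hyS ⟨A, ?_, ?_⟩).1)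
      · intro p hp hp4
        obtain ⟨j, hj⟩ := hA1 p hp hp4
        exact ⟨f j, (hxW j).1, hj⟩
      · intro z hz hz4
        have hzW : z ∈ W := by
          refine ⟨hz, ?_⟩
          calc dist z c ≤ dist z (f i) + dist (f i) c := dist_triangle _ _ _
            _ ≤ 4 + (L - 5) := add_le_add hz4 hdepth
            _ ≤ L := by linarith only [le_refl L]
        have hzr : z ∈ Set.range f := hf ▸ hzW
        obtain ⟨j, rfl⟩ := hzr
        exact hA2 j hz4
  have hLayfin : Lay.Finite := hWfin.subset fun y hy => ⟨hy.1, hy.2.1⟩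
  have hNGfin : NG.Finite := Set.toFinite NG
  have hBle : (Bd.ncard : ℝ) ≤ (NG.ncard : ℝ) + (Lay.ncard : ℝ) := by
    have h1 : Bd.ncard ≤ ((fun i => (f i : EuclideanSpace ℝ (Fin 3))) '' NG ∪ Lay).ncard :=
      Set.ncard_le_ncard hsub ((hNGfin.image _).union hLayfin)
    have h2 := Set.ncard_union_le ((fun i => (f i : EuclideanSpace ℝ (Fin 3))) '' NG) Lay
    have h3 : ((fun i => (f i : EuclideanSpace ℝ (Fin 3))) '' NG).ncard ≤ NG.ncard :=
      Set.ncard_image_le hNGfin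
    exact_mod_cast h1.trans (h2.trans (Nat.add_le_add_right h3 _))
  have hcross' := hcross n f f.injective hf
  have hNG0 : (0 : ℝ) ≤ (NG.ncard : ℝ) := Nat.cast_nonneg _
  rw [hcardNG] at hK2
  rw [hncard]
  have hκC : 2 * κ₀ * (Bd.ncard : ℝ) ≤ 2 * κ₀ * (NG.ncard : ℝ) + 2 * κ₀ * (C₁ * (L + 1) ^ 2) := by
    have h1 : (Bd.ncard : ℝ) ≤ (NG.ncard : ℝ) + C₁ * (L + 1) ^ 2 := by linarith only [hBle, hlayer]
    have h2 := mul_le_mul_of_nonneg_left h1 (by positivity : (0 : ℝ) ≤ 2 * κ₀)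
    linarith only [h2]
  linarith only [hκC, hK2, hcross']

/-- The same by its line name. [folklore] -/
theorem hcpLandscapeGap_exactBarlow : ∃ a h : ℝ, ∃ ha : a ≠ 0, ∃ hh : h ≠ 0, (9 / 10 < a ∧ a < 1 ∧ |h - a * Real.sqrt (2 / 3)| ≤ a / 100) ∧ (∀ η : ℝ, 0 < η → ∃ κ : ℝ, 0 < κ ∧ ∃ C : ℝ, ∀ (a' h' : ℝ), 47 / 50 ≤ a' → a' ≤ 1 → 39 / 50 * a' ≤ h' → h' ≤ 17 / 20 * a' → ∀ s : ℤ → ℤ, Literature.MathematicalPhysics.StatisticalMechanics.IsHaggSeq s → ∀ (B : EuclideanSpace ℝ (Fin 3) →ₗᵢ[ℝ] EuclideanSpace ℝ (Fin 3)) (v c : EuclideanSpace ℝ (Fin 3)) (L : ℝ), 0 ≤ L → 2 * ((Literature.MathematicalPhysics.StatisticalMechanics.hcpPeriodicConfiguration ha hh).energyPerParticle Literature.MathematicalPhysics.StatisticalMechanics.lennardJones) * (({y : EuclideanSpace ℝ (Fin 3) | y ∈ ((fun w => v + B w) '' Literature.MathematicalPhysics.StatisticalMechanics.barlowStacking a'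 h' s) ∧ dist y c ≤ L} : Set (EuclideanSpace ℝ (Fin 3))).ncard : ℝ) + κ * (({y : EuclideanSpace ℝ (Fin 3) | y ∈ ((fun w => v + B w) '' Literature.MathematicalPhysics.StatisticalMechanics.barlowStacking a' h' s) ∧ dist y c ≤ L ∧ ¬ (∃ A : EuclideanSpace ℝ (Fin 3) →ₗᵢ[ℝ] EuclideanSpace ℝ (Fin 3), ∃ e : ↥{z : EuclideanSpace ℝ (Fin 3) | z ∈ ((fun w => v + B w) '' Literature.MathematicalPhysics.StatisticalMechanics.barlowStacking a' h' s) ∧ z ≠ y ∧ dist z y < 13 / 10 * a} ≃ ↥{p : EuclideanSpace ℝ (Fin 3) | p ∈ Literature.MathematicalPhysics.StatisticalMechanics.hcpStacking a h ∧ p ≠ 0 ∧ ‖p‖ < 13 / 10 * a}, ∀ t : ↥{z : EuclideanSpace ℝ (Fin 3) | z ∈ ((fun w => v + B w) '' Literature.MathematicalPhysics.StatisticalMechanics.barlowStacking a' h' s) ∧ z ≠ y ∧ dist z y < 13 / 10 * a}, dist ((t : EuclideanSpace ℝ (Fin 3)) - y) (A ((e t : ↥{p : EuclideanSpace ℝ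 (Fin 3) | p ∈ Literature.MathematicalPhysics.StatisticalMechanics.hcpStacking a h ∧ p ≠ 0 ∧ ‖p‖ < 13 / 10 * a}) : EuclideanSpace ℝ (Fin 3))) ≤ η)} : Set (EuclideanSpace ℝ (Fin 3))).ncard : ℝ) - C * (L + 1) ^ 2 ≤ (∑' y : ↥{y : EuclideanSpace ℝ (Fin 3) | y ∈ ((fun w => v + B w) '' Literature.MathematicalPhysics.StatisticalMechanics.barlowStacking a' h' s) ∧ dist y c ≤ L}, (∑' z : ↥{z : EuclideanSpace ℝ (Fin 3) | z ∈ ((fun w => v + B w) '' Literature.MathematicalPhysics.StatisticalMechanics.barlowStacking a' h' s) ∧ z ≠ (y : EuclideanSpace ℝ (Fin 3))}, Literature.MathematicalPhysics.StatisticalMechanics.lennardJones (dist (y : EuclideanSpace ℝ (Fin 3)) (z : EuclideanSpace ℝ (Fin 3)))))) :=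
  stub_hcpLandscapeGap_exactBarlow

end Summit.AtomisticToContinuum.Crystallization.Theorems.HcpLandscapeGapBirth
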